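import Summits.Parity.GeneralizedHardyLittlewood.Theorems.LeeYangFibresModelHyperbolicityCellRate
import Summits.Parity.GeneralizedHardyLittlewood.Theorems.LeeYangFibresModelHyperbolicityCellLimit
import Summits.Parity.GeneralizedHardyLittlewood.Theorems.LeeYangFibresModelCellFactsDensityBounds
import Summits.Parity.GeneralizedHardyLittlewood.Theorems.LeeYangFibresModelCellFactsParityPoint
import HarnessLib

/-!
# Route `LeeYangFibres`: proof of the support item `ModelCellFacts` (stmt-Parity-14111)

`Summit.Parity.GeneralizedHardyLittlewood.Theses.LeeYangFibres.ModelCellFacts` — the parity-free anatomy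
of the `N^{1/u}`-rough integers: for every `ε > 0` and all large `u` there are an odd `j₁` and an even
`j₂` in `[2, u-2]`, a constant `c > 0` and `N₀` such that for `N ≥ N₀`, with
`A_j(N) = #{m ≤ N : P⁻(m) > N^{1/u}, Ω(m) = j}`:
(i) `A_j(N) ≥ c·N/log N` for `j ∈ {1, j₁±1, j₁, j₂±1, j₂}`;
(ii) `(1-ε)·A_j(N)² ≤ A_{j-1}(N)·A_{j+1}(N)` for `j ∈ {j₁, j₂}`;
(iii) `|Σ_{j≤u} (-1)^j A_j(N)| ≤ ε·Σ_{j≤u} A_j(N)`.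

Proof. The arithmetic input is Alladi's cell asymptotics `A_j(N)·log N/N → I_j(u)` (`N → ∞`, `u ≥ 2`
an integer, every `j ≥ 1`), ALREADY in the tree as
`CellAsymptotics u := stub_cellLimit stub_calculus (stub_cellRate stub_calculus) u _`
(files `LeeYangFibresModelHyperbolicity{Defs,Calculus,CellRate,CellLimit}.lean` of the crux line
`window-chain-transport`; `cell u N j` of `ModelHyperbolicityLoadBearing.lean` is verbatim the item's
inlined finset). Everything else is real analysis of the densities `I_{i+1} = cellDensity i`:
positivity `I_j(u) > 0` for `u > j` gives (i) with `c = ½·min_{1≤j<u} I_j(u)`; the margin lemma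
`eventually_margin` (file `…DensityBounds`) gives `(1-ε) I_j(u)² < I_{j-1}(u) I_{j+1}(u)` at the two bulk
indices `j₂ = 2m+2`, `j₁ = 2m+3` (`m > 1/ε`) for all large `u`, whence (ii); and the parity-point bound
`|Σ_j (-1)^j I_j(u)| ≤ 1/(u-1) < ε ≤ ε·Σ_j I_j(u)` (file `…ParityPoint`, the adjoint-equation argument)
gives (iii). Limits are turned into inequalities for `N ≥ N₀` by strictness of the limiting inequalities.

References: K. Alladi, Quart. J. Math. Oxford (2) 33 (1982) 129–148 and Trans. AMS 272 (1982) 87–105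
[Alladi1982]; G. Tenenbaum, *Introduction to analytic and probabilistic number theory*, III.6
[Tenenbaum2015]. No named facts are used: the result is unconditional.
-/

noncomputable section

namespace Summit.Parity.GeneralizedHardyLittlewood.Theorems

namespace ModelCellFacts

open scoped BigOperators Topology
open Filter Set
open Summit.Parity.GeneralizedHardyLittlewood.Cruxes.ModelHyperbolicity.WindowChainTransport
open Summit.Parity.GeneralizedHardyLittlewood.Theorems.ModelHyperbolicity.Negative (cell)

/-! ## Small helpers -/

/-- A positive function on a finite set is bounded below by a positive constant, strictly. -/
theorem exists_pos_forall_lt {S : Finset ℕ} {f : ℕ → ℝ} (h : ∀ j ∈ S, 0 < f j) :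
    ∃ c : ℝ, 0 < c ∧ ∀ j ∈ S, c < f j := by
  rcases S.eq_empty_or_nonempty with hS | hS
  · exact ⟨1, one_pos, by simp [hS]⟩
  · obtain ⟨j₀, hj₀, hmin⟩ := S.exists_min_image f hS
    exact ⟨f j₀ / 2, by linarith [h j₀ hj₀], fun j hj => by linarith [hmin j hj, h j₀ hj₀]⟩

/-- Unconditional cell asymptotics at integer roughness `u ≥ 2`, indexed by `j ≥ 1`:
`A_j(N)·log N/N → I_j(u) = cellDensity (j-1) u`. -/
theorem tendsto_cell {u : ℕ} (hu : 2 ≤ u) {j : ℕ} (hj : 1 ≤ j) :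
    Tendsto (fun N : ℕ => (cell u N j : ℝ) * Real.log N / N) atTop (nhds (cellDensity (j - 1) u)) := by
  have h := stub_cellLimit stub_calculus (stub_cellRate stub_calculus) u hu (j - 1)
  rwa [Nat.sub_add_cancel hj] at h

/-- For `N ≥ 2`: `A = (A·log N/N)·(N/log N)`. -/
theorem cell_eq_mul {N : ℕ} (hN : 2 ≤ N) (u j : ℕ) :
    (cell u N j : ℝ) = (cell u N j : ℝ) * Real.log N / N * ((N : ℝ) / Real.log N) := by
  have hN0 : (0 : ℝ) < N := by exact_mod_cast (show 0 < N by omega)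
  have hL : 0 < Real.log N := Real.log_pos (by exact_mod_cast (show 1 < N by omega))
  field_simp

/-! ## (i) lower bounds for the cells -/

/-- (i): with `2c < min_{1 ≤ j < u} I_j(u)`, eventually `c·N/log N ≤ A_j(N)` for all `1 ≤ j < u`. -/
theorem eventually_lower {u : ℕ} (hu : 2 ≤ u) {c : ℝ}
    (hc : ∀ j ∈ Finset.Ico 1 u, c < cellDensity (j - 1) u) :
    ∀ᶠ N : ℕ in atTop, ∀ j ∈ Finset.Ico 1 u, c * (N : ℝ) / Real.log N ≤ (cell u N j : ℝ) := by
  rw [Filter.eventually_all_finset]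
  intro j hj
  have hj1 : 1 ≤ j := (Finset.mem_Ico.mp hj).1
  filter_upwards [(tendsto_cell hu hj1).eventually (eventually_gt_nhds (hc j hj)),
    eventually_ge_atTop 2] with N hN hN2
  have hN0 : (0 : ℝ) < N := by exact_mod_cast (show 0 < N by omega)
  have hL : 0 < Real.log N := Real.log_pos (by exact_mod_cast (show 1 < N by omega))
  rw [cell_eq_mul hN2 u j, mul_div_assoc]
  exact mul_le_mul_of_nonneg_right hN.le (div_nonneg hN0.le hL.le)

/-! ## (ii) the vanishing log-concavity margins -/

/-- (ii): a strict margin of the densities at `j = k+2` transfers to the cells for large `N`. -/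
theorem eventually_margin_cell {u : ℕ} (hu : 2 ≤ u) {ε : ℝ} {k : ℕ}
    (hmar : (1 - ε) * cellDensity (k + 1) u ^ 2 < cellDensity k u * cellDensity (k + 2) u) :
    ∀ᶠ N : ℕ in atTop, (1 - ε) * (cell u N (k + 2) : ℝ) ^ 2 ≤
      (cell u N (k + 2 - 1) : ℝ) * (cell u N (k + 2 + 1) : ℝ) := by
  have h1 := tendsto_cell hu (j := k + 1) (by omega)
  have h2 := tendsto_cell hu (j := k + 2) (by omega)
  have h3 := tendsto_cell hu (j := k + 3) (by omega)
  simp only [Nat.add_sub_cancel] at h1 h2 h3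
  have hlim := (h1.mul h3).sub (h2.pow 2 |>.const_mul (1 - ε))
  have hpos : 0 < cellDensity k u * cellDensity (k + 2) u - (1 - ε) * cellDensity (k + 1) u ^ 2 := by
    linarith
  filter_upwards [hlim.eventually (eventually_gt_nhds hpos), eventually_ge_atTop 2] with N hN hN2
  rw [show k + 2 - 1 = k + 1 by omega]
  have hN0 : (0 : ℝ) < N := by exact_mod_cast (show 0 < N by omega)
  have hL : 0 < Real.log N := Real.log_pos (by exact_mod_cast (show 1 < N by omega))
  set r : ℝ := (N : ℝ) / Real.log N with hr
  have hr0 : 0 ≤ r := div_nonneg hN0.le hL.le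
  rw [cell_eq_mul hN2 u (k + 2), cell_eq_mul hN2 u (k + 1), cell_eq_mul hN2 u (k + 2 + 1)]
  rw [sub_pos] at hN
  rw [← hr]
  have : (1 - ε) * ((cell u N (k + 2) : ℝ) * Real.log N / N * r) ^ 2 =
      ((1 - ε) * ((cell u N (k + 2) : ℝ) * Real.log N / N) ^ 2) * r ^ 2 := by ring
  rw [this, show (cell u N (k + 1) : ℝ) * Real.log N / N * r * ((cell u N (k + 2 + 1) : ℝ) * Real.log N / N * r)
    = ((cell u N (k + 1) : ℝ) * Real.log N / N * ((cell u N (k + 2 + 1) : ℝ) * Real.log N / N)) * r ^ 2 by ring]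
  exact mul_le_mul_of_nonneg_right hN.le (sq_nonneg r)

/-! ## (iii) the parity balance -/

/-- (iii): for `u ≥ 2` with `1/(u-1) < ε`, eventually `|Σ_{j≤u} (-1)^j A_j(N)| ≤ ε·Σ_{j≤u} A_j(N)`. -/
theorem eventually_parity {u : ℕ} (hu : 2 ≤ u) {ε : ℝ} (hε : 1 / ((u : ℝ) - 1) < ε) :
    ∀ᶠ N : ℕ in atTop, |∑ j ∈ Finset.Icc 1 u, (-1 : ℝ) ^ j * (cell u N j : ℝ)| ≤
      ε * ∑ j ∈ Finset.Icc 1 u, (cell u N j : ℝ) := by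
  -- limits of the two normalised sums
  have hS : Tendsto (fun N : ℕ => ∑ j ∈ Finset.Icc 1 u, (-1 : ℝ) ^ j * ((cell u N j : ℝ) * Real.log N / N))
      atTop (nhds (∑ j ∈ Finset.Icc 1 u, (-1 : ℝ) ^ j * cellDensity (j - 1) u)) :=
    tendsto_finsetSum _ fun j hj => (tendsto_cell hu (Finset.mem_Icc.mp hj).1).const_mul _
  have hW : Tendsto (fun N : ℕ => ∑ j ∈ Finset.Icc 1 u, (cell u N j : ℝ) * Real.log N / N)
      atTop (nhds (∑ j ∈ Finset.Icc 1 u, cellDensity (j - 1) u)) :=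
    tendsto_finsetSum _ fun j hj => tendsto_cell hu (Finset.mem_Icc.mp hj).1
  -- the limiting inequality is strict
  have hW1 : 1 ≤ ∑ j ∈ Finset.Icc 1 u, cellDensity (j - 1) u := by
    have h1 : (1 : ℕ) ∈ Finset.Icc 1 u := Finset.mem_Icc.mpr ⟨le_rfl, by omega⟩
    have := Finset.single_le_sum (f := fun j => cellDensity (j - 1) (u : ℝ))
      (fun j _ => calc_nonneg (j - 1) (u : ℝ)) h1
    simpa using this
  have hε0 : 0 < ε := lt_of_le_of_lt (by
    have : (1 : ℝ) ≤ (u : ℝ) - 1 := by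
      have : (2 : ℝ) ≤ u := by exact_mod_cast hu
      linarith
    positivity) hε
  have hstrict : |∑ j ∈ Finset.Icc 1 u, (-1 : ℝ) ^ j * cellDensity (j - 1) u| <
      ε * ∑ j ∈ Finset.Icc 1 u, cellDensity (j - 1) u := by
    calc |∑ j ∈ Finset.Icc 1 u, (-1 : ℝ) ^ j * cellDensity (j - 1) u| ≤ 1 / ((u : ℝ) - 1) :=
          abs_alternating_sum_le hu
      _ < ε := hε
      _ ≤ ε * ∑ j ∈ Finset.Icc 1 u, cellDensity (j - 1) u := by nlinarith
  have hlim := (hW.const_mul ε).sub hS.abs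
  have hpos : 0 < ε * ∑ j ∈ Finset.Icc 1 u, cellDensity (j - 1) u -
      |∑ j ∈ Finset.Icc 1 u, (-1 : ℝ) ^ j * cellDensity (j - 1) u| := by linarith
  filter_upwards [hlim.eventually (eventually_gt_nhds hpos), eventually_ge_atTop 2] with N hN hN2
  have hN0 : (0 : ℝ) < N := by exact_mod_cast (show 0 < N by omega)
  have hL : 0 < Real.log N := Real.log_pos (by exact_mod_cast (show 1 < N by omega))
  set r : ℝ := (N : ℝ) / Real.log N with hr
  have hr0 : 0 ≤ r := div_nonneg hN0.le hL.le
  have hsum1 : ∑ j ∈ Finset.Icc 1 u, (-1 : ℝ) ^ j * (cell u N j : ℝ) =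
      (∑ j ∈ Finset.Icc 1 u, (-1 : ℝ) ^ j * ((cell u N j : ℝ) * Real.log N / N)) * r := by
    rw [Finset.sum_mul]
    refine Finset.sum_congr rfl fun j _ => ?_
    rw [hr]; field_simp
  have hsum2 : ∑ j ∈ Finset.Icc 1 u, (cell u N j : ℝ) =
      (∑ j ∈ Finset.Icc 1 u, (cell u N j : ℝ) * Real.log N / N) * r := by
    rw [Finset.sum_mul]
    refine Finset.sum_congr rfl fun j _ => ?_
    rw [hr]; field_simp
  rw [hsum1, hsum2, abs_mul, abs_of_nonneg hr0, ← mul_assoc]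
  refine mul_le_mul_of_nonneg_right ?_ hr0
  simp only [sub_pos] at hN
  exact hN.le

end ModelCellFacts

open ModelCellFacts Filter
open Summit.Parity.GeneralizedHardyLittlewood.Cruxes.ModelHyperbolicity.WindowChainTransport
open Summit.Parity.GeneralizedHardyLittlewood.Theorems.ModelHyperbolicity.Negative (cell)

/-- **`ModelCellFacts`, in the `cell` notation** (`cell u N j = A_j(N)` is verbatim the item's inlined
finset cardinality). -/
theorem modelCellFacts_cell (ε : ℝ) (hε : 0 < ε) :
    ∃ u₀ : ℕ, ∀ u : ℕ, u₀ ≤ u → ∃ j₁ j₂ : ℕ, Odd j₁ ∧ Even j₂ ∧ 2 ≤ j₁ ∧ j₁ + 2 ≤ u ∧ 2 ≤ j₂ ∧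
      j₂ + 2 ≤ u ∧ ∃ c : ℝ, 0 < c ∧ ∃ N₀ : ℕ, ∀ N : ℕ, N₀ ≤ N →
        (∀ j ∈ ({1, j₁ - 1, j₁, j₁ + 1, j₂ - 1, j₂, j₂ + 1} : Finset ℕ),
          c * (N : ℝ) / Real.log N ≤ (cell u N j : ℝ)) ∧
        (∀ j ∈ ({j₁, j₂} : Finset ℕ),
          (1 - ε) * (cell u N j : ℝ) ^ 2 ≤ (cell u N (j - 1) : ℝ) * (cell u N (j + 1) : ℝ)) ∧
        |∑ j ∈ Finset.Icc 1 u, (-1 : ℝ) ^ j * (cell u N j : ℝ)| ≤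
          ε * ∑ j ∈ Finset.Icc 1 u, (cell u N j : ℝ) := by
  obtain ⟨m, hm⟩ := exists_nat_gt (1 / ε)
  -- the two bulk indices `j₂ = 2m+2` (even) and `j₁ = 2m+3` (odd) exceed `1/ε`
  have hk : ∀ k : ℕ, 2 * m ≤ k → (1 - ε) * ((k : ℝ) + 2) < k + 1 := by
    intro k hk'
    have hkm : (2 * m : ℕ) ≤ (k : ℝ) := by exact_mod_cast hk'
    push_cast at hkm
    have h1 : 1 / ε < (k : ℝ) + 2 := by linarith [(Nat.cast_nonneg m : (0 : ℝ) ≤ m)]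
    have h2 : 1 < ε * ((k : ℝ) + 2) := by
      rw [div_lt_iff₀ hε] at h1; linarith
    nlinarith
  obtain ⟨U, hU⟩ := Filter.eventually_atTop.mp
    ((eventually_margin ε (2 * m + 1) (hk _ (by omega))).and (eventually_margin ε (2 * m) (hk _ le_rfl)))
  refine ⟨max (2 * m + 5) ⌈U⌉₊, fun u hu => ?_⟩
  have hu5 : 2 * m + 5 ≤ u := le_of_max_le_left hu
  have huU : U ≤ (u : ℝ) := (Nat.le_ceil U).trans (by exact_mod_cast le_of_max_le_right hu)
  have hu2 : 2 ≤ u := by omega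
  refine ⟨2 * m + 3, 2 * m + 2, ⟨m + 1, by ring⟩, ⟨m + 1, by ring⟩, by omega, by omega, by omega,
    by omega, ?_⟩
  -- the constant `c`
  obtain ⟨c, hc, hclt⟩ : ∃ c : ℝ, 0 < c ∧ ∀ j ∈ Finset.Ico 1 u, c < cellDensity (j - 1) u := by
    refine exists_pos_forall_lt fun j hj => ?_
    obtain ⟨hj1, hju⟩ := Finset.mem_Ico.mp hj
    refine calc_pos (j - 1) u ?_
    have : ((j - 1 : ℕ) : ℝ) + 1 = j := by
      rw [Nat.cast_sub hj1]; push_cast; ring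
    rw [this]; exact_mod_cast hju
  refine ⟨c, hc, ?_⟩
  -- the three eventualities
  obtain ⟨hm1, hm2⟩ := hU u huU
  have E2 : ∀ᶠ N : ℕ in atTop, ∀ j ∈ ({2 * m + 3, 2 * m + 2} : Finset ℕ),
      (1 - ε) * (cell u N j : ℝ) ^ 2 ≤ (cell u N (j - 1) : ℝ) * (cell u N (j + 1) : ℝ) := by
    rw [Filter.eventually_all_finset]
    intro j hj
    simp only [Finset.mem_insert, Finset.mem_singleton] at hj
    rcases hj with rfl | rfl
    · exact eventually_margin_cell hu2 hm1
    · exact eventually_margin_cell hu2 hm2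
  have E3 := eventually_parity hu2 (ε := ε) (by
    have h1 : (1 : ℝ) / ε < (u : ℝ) - 1 := by
      have : (2 * m + 5 : ℕ) ≤ (u : ℝ) := by exact_mod_cast hu5
      push_cast at this
      linarith [(Nat.cast_nonneg m : (0 : ℝ) ≤ m)]
    have h2 : (0 : ℝ) < (u : ℝ) - 1 := lt_trans (by positivity) h1
    rwa [div_lt_iff₀ hε, ← div_lt_iff₀' h2] at h1)
  obtain ⟨N₀, hN₀⟩ := Filter.eventually_atTop.mp ((eventually_lower hu2 hclt).and (E2.and E3))
  refine ⟨N₀, fun N hN => ?_⟩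
  obtain ⟨h1, h2, h3⟩ := hN₀ N hN
  refine ⟨fun j hj => h1 j ?_, h2, h3⟩
  simp only [Finset.mem_insert, Finset.mem_singleton] at hj
  simp only [Finset.mem_Ico]
  omega

/-- **Item stmt-Parity-14111 `ModelCellFacts` (route `LeeYangFibres`), proved.** For every `ε > 0` and
all large `u` there are an odd `j₁` and an even `j₂` in `[2, u-2]`, `c > 0` and `N₀` such that for
`N ≥ N₀` the rough `Ω`-cells `A_j(N) = #{m ≤ N : P⁻(m) > N^{1/u}, Ω(m) = j}` satisfy the seven lower
bounds `A_j(N) ≥ cN/log N`, the two vanishing log-concavity margins `(1-ε)A_j² ≤ A_{j-1}A_{j+1}`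
(`j = j₁, j₂`), and the parity balance `|Σ_j (-1)^j A_j(N)| ≤ ε Σ_j A_j(N)`. Unconditional. -/
theorem modelCellFacts_proof :
    Summit.Parity.GeneralizedHardyLittlewood.Theses.LeeYangFibres.ModelCellFacts := by
  intro ε hε
  exact modelCellFacts_cell ε hε

end Summit.Parity.GeneralizedHardyLittlewood.Theorems

end
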